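import Summits.RiemannHypothesis.RiemannHypothesis.Theorems.TiltedLandingLaw421R3SinkConePos

/-!
# W-08 law421 line — regime 3′ SINK: the THIN far strip (C1 IMAGE CANDIDATE «SinkThin» v2 = sketch «ThinStrip» v7 §1–§3, rh-idea-5 g40; NOT frozen, NOT a token until keyed)

Typing support for NON-CONE MEMO-1's ADDENDUM «fat vs thin far strip» (pub/ideators/rh-idea-5/g40/doc/).  Every far zero of a legal frame has
`|Im u| ≤ Hs` (frame hypothesis), so the far family of the sink's assembly lives in the THIN far strip
`ThinStrip xv R Hs u := R/2 ≤ |Re u − xv| ∧ |Im u| ≤ Hs ⊆ MaxStrip xv R` (`2·Hs ≤ R`).  #1262 «SinkTemplate» states its kernel laws on the maximal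
strip «so that thin lids inherit them by restriction» (`MaxStrip` docstring); this file types the restriction: the thin strip and its boundary, kernel
domination on it (`KernelDomThin`), the restriction lemma from `KernelDom`, the identification at `Hs = R/2`, the THIN-CONE condition
`Hs² < (R/2 − |Re w − xv|)² + (Im w)²` under which `c(u) > 0` on the whole thin strip (automatic when `|Re w − xv| + Hs < R/2`; at `Hs = R/2` it is
exactly `ConeChild`; every legal datum of the thin claim is thin-cone once `2·(Hs + h) ≤ R`, `thinCone_of_datum`), and the assembly with a POINTWISE kernel hypothesis at the far zeros (the bookkeeping of `sinkAssembly` verbatim), whence the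
thin-strip assembly.  All (K), sorry-free; the (T)-shaped `LemmaHThinSig` is a named `Prop` asserted by nothing.
RH is not proved here or anywhere in this line; ⟨33346⟩/⟨33347⟩ are OPEN.
-/

namespace RhW08.SinkThin

open Complex
open scoped ComplexConjugate
open RhW08.SinkTemplate RhW08.SinkBdry RhW08.SinkConePos

/-! ## §1 The thin far strip and kernel domination on it -/

/-- the THIN far strip of window `R` and lid height `Hs` about the axis `Re z = xv`: `R/2 ≤ |Re u − xv|` and `|Im u| ≤ Hs` (the true far region of a frame
whose zeros all have `|Im| ≤ Hs`). -/
def ThinStrip (xv R Hs : ℝ) (u : ℂ) : Prop := R / 2 ≤ |u.re - xv| ∧ |u.im| ≤ Hs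

/-- the boundary of the thin far strip: the two inner column segments `|Re u − xv| = R/2, |Im u| ≤ Hs` and the four lid rays `|Im u| = Hs`. -/
def ThinStripBdry (xv R Hs : ℝ) (u : ℂ) : Prop :=
  (|u.re - xv| = R / 2 ∧ |u.im| ≤ Hs) ∨ (R / 2 ≤ |u.re - xv| ∧ |u.im| = Hs)

/-- (K) kernel domination with multiplier `σ` on the THIN far strip. -/
def KernelDomThin {κ : Type} [Fintype κ] (xv R Hs : ℝ) (cs : κ → Cut) (w : ℂ) (σ : ℝ) : Prop :=
  ∀ u : ℂ, ThinStrip xv R Hs u → cutNumer cs w u ≤ σ * farPairC w u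

/-- (K∂) kernel domination on the boundary of the thin far strip only. -/
def KernelDomThinBdry {κ : Type} [Fintype κ] (xv R Hs : ℝ) (cs : κ → Cut) (w : ℂ) (σ : ℝ) : Prop :=
  ∀ u : ℂ, ThinStripBdry xv R Hs u → cutNumer cs w u ≤ σ * farPairC w u

/-- (T-shape, asserted by nothing) LEMMA H on the thin strip: boundary domination suffices when the poles `w, w̄, p_k, p̄_k` lie inside the near window. -/
def LemmaHThinSig : Prop :=
  ∀ (κ : Type) [Fintype κ] (xv R Hs : ℝ) (cs : κ → Cut) (w : ℂ) (σ : ℝ),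
    |w.re - xv| < R / 2 → (∀ k, |(cs k).p.re - xv| < R / 2) →
    KernelDomThinBdry xv R Hs cs w σ → KernelDomThin xv R Hs cs w σ

/-- the thin strip lies in the maximal strip when `Hs ≤ R/2` (frames: `2·Hs ≤ R`). -/
theorem maxStrip_of_thinStrip {xv R Hs : ℝ} {u : ℂ} (hHs : Hs ≤ R / 2) (hu : ThinStrip xv R Hs u) : MaxStrip xv R u :=
  ⟨hu.1, hu.2.trans hHs⟩

/-- at lid height `Hs = R/2` the thin strip IS the maximal strip. -/
theorem thinStrip_half_iff (xv R : ℝ) (u : ℂ) : ThinStrip xv R (R / 2) u ↔ MaxStrip xv R u := Iff.rfl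

/-- the boundary of the thin strip is part of the thin strip. -/
theorem thinStrip_of_bdry {xv R Hs : ℝ} {u : ℂ} (hu : ThinStripBdry xv R Hs u) : ThinStrip xv R Hs u := by
  rcases hu with ⟨h1, h2⟩ | ⟨h1, h2⟩
  · exact ⟨h1.ge, h2⟩
  · exact ⟨h1, h2.le⟩

/-- RESTRICTION: kernel domination on the maximal strip gives it on every thin strip with `Hs ≤ R/2` — every landed max-strip (K) theorem restricts. -/
theorem kernelDomThin_of_kernelDom {κ : Type} [Fintype κ] {xv R Hs : ℝ} {cs : κ → Cut} {w : ℂ} {σ : ℝ} (hHs : Hs ≤ R / 2)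
    (hK : KernelDom xv R cs w σ) : KernelDomThin xv R Hs cs w σ :=
  fun u hu => hK u (maxStrip_of_thinStrip hHs hu)

/-- at `Hs = R/2` thin-strip domination IS max-strip domination. -/
theorem kernelDomThin_half_iff {κ : Type} [Fintype κ] (xv R : ℝ) (cs : κ → Cut) (w : ℂ) (σ : ℝ) :
    KernelDomThin xv R (R / 2) cs w σ ↔ KernelDom xv R cs w σ := Iff.rfl

/-- thin-strip domination implies domination on the thin boundary (the converse is Lemma H). -/
theorem kernelDomThinBdry_of_thin {κ : Type} [Fintype κ] {xv R Hs : ℝ} {cs : κ → Cut} {w : ℂ} {σ : ℝ}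
    (hK : KernelDomThin xv R Hs cs w σ) : KernelDomThinBdry xv R Hs cs w σ :=
  fun u hu => hK u (thinStrip_of_bdry hu)

/-! ## §2 The thin-cone condition: `c(u) > 0` on the whole thin strip -/

/-- THIN-CONE datum: `Hs² < (R/2 − |Re w − xv|)² + (Im w)²` — the child's pair kernel `c(u)` is positive on the whole thin strip of lid height `Hs`. -/
def ThinCone (xv R Hs : ℝ) (w : ℂ) : Prop := Hs ^ 2 < (R / 2 - |w.re - xv|) ^ 2 + w.im ^ 2

/-- at lid height `Hs = R/2` the thin-cone condition is exactly `ConeChild`. -/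
theorem thinCone_half_iff (xv R : ℝ) (w : ℂ) : ThinCone xv R (R / 2) w ↔ ConeChild xv R w := by
  unfold ThinCone ConeChild
  have h := sq_abs (w.re - xv)
  constructor
  · intro hc; nlinarith [hc, h]
  · intro hc; nlinarith [hc, h]

/-- a child within `R/2 − Hs` of the axis is thin-cone (`0 ≤ Hs`): with `Hs ≪ R` EVERY child near the axis is cone on the thin strip. -/
theorem thinCone_of_near {xv R Hs : ℝ} {w : ℂ} (hHs : 0 ≤ Hs) (h : |w.re - xv| + Hs < R / 2) : ThinCone xv R Hs w := by
  unfold ThinCone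
  have h1 : Hs < R / 2 - |w.re - xv| := by linarith
  have h2 : Hs ^ 2 < (R / 2 - |w.re - xv|) ^ 2 := by
    have := abs_nonneg (w.re - xv)
    nlinarith [h1, hHs]
  nlinarith [h2, sq_nonneg w.im]

/-- ★ POSITIVITY ON THE THIN STRIP: for a child `w` inside the near window (`|Re w − xv| ≤ R/2`, `0 < Im w`) satisfying the thin-cone condition, `c(u) > 0` at
every point of the thin far strip (closed form `pairCForm_pos` of #1279: `b² < (δ − ξ)² + t²`). -/
theorem farPairC_pos_of_thinCone {xv R Hs : ℝ} {w u : ℂ} (hw : |w.re - xv| ≤ R / 2) (ht : 0 < w.im) (hc : ThinCone xv R Hs w)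
    (hu : ThinStrip xv R Hs u) : 0 < farPairC w u := by
  rw [farPairC_eq w u xv]
  apply pairCForm_pos ht
  unfold ThinCone at hc
  obtain ⟨hξ, hb⟩ := hu
  have hb2 : u.im ^ 2 ≤ Hs ^ 2 := by
    have h0 : 0 ≤ Hs := (abs_nonneg _).trans hb
    have := abs_le.1 hb
    nlinarith [this.1, this.2, h0, sq_abs u.im]
  -- `R/2 − |δ| ≤ |ξ| − |δ| ≤ |δ − ξ|`, both sides of the first nonnegative
  have hd0 : 0 ≤ R / 2 - |w.re - xv| := by linarith
  have htri : R / 2 - |w.re - xv| ≤ |(w.re - xv) - (u.re - xv)| := by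
    have h1 := abs_sub_abs_le_abs_sub (u.re - xv) (w.re - xv)
    have h2 : |(u.re - xv) - (w.re - xv)| = |(w.re - xv) - (u.re - xv)| := abs_sub_comm _ _
    linarith
  have hsq : (R / 2 - |w.re - xv|) ^ 2 ≤ ((w.re - xv) - (u.re - xv)) ^ 2 := by
    rw [← sq_abs ((w.re - xv) - (u.re - xv))]
    exact pow_le_pow_left₀ hd0 htri 2
  linarith [hb2, hc, hsq]

/-- … in particular on the thin boundary. -/
theorem farPairC_pos_of_thinCone_bdry {xv R Hs : ℝ} {w u : ℂ} (hw : |w.re - xv| ≤ R / 2) (ht : 0 < w.im) (hc : ThinCone xv R Hs w)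
    (hu : ThinStripBdry xv R Hs u) : 0 < farPairC w u :=
  farPairC_pos_of_thinCone hw ht hc (thinStrip_of_bdry hu)

/-- monotonicity of thin-strip domination in the multiplier for a thin-cone child (as `kernelDom_mono` on the maximal strip). -/
theorem kernelDomThin_mono {κ : Type} [Fintype κ] {xv R Hs : ℝ} {cs : κ → Cut} {w : ℂ} {σ σ' : ℝ} (hw : |w.re - xv| ≤ R / 2) (ht : 0 < w.im)
    (hc : ThinCone xv R Hs w) (hσ : σ ≤ σ') (hK : KernelDomThin xv R Hs cs w σ) : KernelDomThin xv R Hs cs w σ' := by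
  intro u hu
  have hcu := farPairC_pos_of_thinCone hw ht hc hu
  exact (hK u hu).trans (mul_le_mul_of_nonneg_right hσ hcu.le)

/-- a child within `R/2 − Hs` of the axis, closed form (`0 ≤ Hs`, `0 < Im w`): thin-cone. -/
theorem thinCone_of_near_le {xv R Hs : ℝ} {w : ℂ} (hHs : 0 ≤ Hs) (ht : 0 < w.im) (h : |w.re - xv| + Hs ≤ R / 2) : ThinCone xv R Hs w := by
  unfold ThinCone
  have h1 : Hs ≤ R / 2 - |w.re - xv| := by linarith
  have h2 : Hs ^ 2 ≤ (R / 2 - |w.re - xv|) ^ 2 := pow_le_pow_left₀ hHs h1 2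
  nlinarith [h2, pow_pos ht 2]

/-- ★ SUPPLIER MEETS CONSUMER: under the thin claim's binders every legal datum is thin-cone — the child `w` lies in the parent's nested disc
(`(Re w − xv)² + (Im w)² ≤ (Im v)²`, `Im v ≤ h`), so `|Re w − xv| ≤ h`, and `2·(Hs + h) ≤ R` puts it within `R/2 − Hs` of the axis; hence `c(u) > 0` on the
whole thin strip (`farPairC_pos_of_thinCone`) and the (K) side is cone-type for EVERY datum (the non-cone hole of the fat lid is gone). -/
theorem thinCone_of_datum {xv R h Hs : ℝ} {v w : ℂ} (hHs0 : 0 ≤ Hs) (hHR : 2 * (Hs + h) ≤ R) (hY : 0 < v.im) (hYh : v.im ≤ h) (ht : 0 < w.im)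
    (hnest : (w.re - xv) ^ 2 + w.im ^ 2 ≤ v.im ^ 2) : ThinCone xv R Hs w := by
  have hδ : |w.re - xv| ≤ v.im := abs_le_of_sq_le_sq (by nlinarith [sq_nonneg w.im]) hY.le
  exact thinCone_of_near_le hHs0 ht (by linarith)

/-- … so the datum's pair kernel is positive on the whole thin strip. -/
theorem farPairC_pos_of_datum {xv R h Hs : ℝ} {v w u : ℂ} (hHs0 : 0 ≤ Hs) (hHR : 2 * (Hs + h) ≤ R) (hY : 0 < v.im) (hYh : v.im ≤ h)
    (ht : 0 < w.im) (hnest : (w.re - xv) ^ 2 + w.im ^ 2 ≤ v.im ^ 2) (hu : ThinStrip xv R Hs u) : 0 < farPairC w u := by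
  have hδ : |w.re - xv| ≤ v.im := abs_le_of_sq_le_sq (by nlinarith [sq_nonneg w.im]) hY.le
  have hw : |w.re - xv| ≤ R / 2 := by linarith
  exact farPairC_pos_of_thinCone hw ht (thinCone_of_datum hHs0 hHR hY hYh ht hnest) hu

/-! ## §3 The assembly with a pointwise kernel hypothesis, and the thin-strip assembly -/

/-- ASSEMBLY, POINTWISE FORM: the bookkeeping of `sinkAssembly` (#1262) needs kernel domination ONLY at the far zeros `a i` — no region at all.  Data and
conclusion otherwise exactly as `AssemblySig`: weighted seam reads through the two-point identity, the `Finset`/`tsum` exchange, (E), hence `L_cert ≤ L`. -/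
theorem lcert_le_of_pointwise (κ : Type) [Fintype κ] (ι : Type) (a : ι → ℂ) (m : ι → ℝ) (xv : ℝ) (cs : κ → Cut) (w G : ℂ) (L σ : ℝ)
    (hm : ∀ i, 0 ≤ m i) (hadm : CutsAdmissible xv cs) (hK : ∀ i, cutNumer cs w (a i) ≤ σ * farPairC w (a i))
    (hsum : ∀ k, Summable fun i => m i * (conj (cs k).e * (farPairK (a i) w - farPairK (a i) (cs k).p)).re)
    (hsumc : Summable fun i => m i * farPairC w (a i)) (hE : -G.im = ∑' i, m i * farPairC w (a i))
    (hseam : ∀ k, (conj (cs k).e * G).re - ∑' i, m i * (conj (cs k).e * (farPairK (a i) w - farPairK (a i) (cs k).p)).re ≤ L) :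
    Lcert cs G σ ≤ L := by
  set T : κ → ι → ℝ := fun k i => m i * (conj (cs k).e * (farPairK (a i) w - farPairK (a i) (cs k).p)).re with hT
  have h1 : ∀ k, (cs k).y * (conj (cs k).e * G).re ≤ (cs k).y * L + (cs k).y * ∑' i, T k i := by
    intro k
    have hy : 0 ≤ (cs k).y := (hadm.1 k).1
    have hs : (conj (cs k).e * G).re ≤ L + ∑' i, T k i := by
      have := hseam k
      linarith
    nlinarith [mul_le_mul_of_nonneg_left hs hy]
  have h2 : ∑ k, (cs k).y * (conj (cs k).e * G).re ≤ L + ∑ k, (cs k).y * ∑' i, T k i := by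
    calc ∑ k, (cs k).y * (conj (cs k).e * G).re
        ≤ ∑ k, ((cs k).y * L + (cs k).y * ∑' i, T k i) := Finset.sum_le_sum fun k _ => h1 k
      _ = (∑ k, (cs k).y) * L + ∑ k, (cs k).y * ∑' i, T k i := by
          rw [Finset.sum_add_distrib, Finset.sum_mul]
      _ = L + ∑ k, (cs k).y * ∑' i, T k i := by rw [hadm.2, one_mul]
  have hsum' : ∀ k, Summable fun i => (cs k).y * T k i := fun k => (hsum k).mul_left _
  have h3 : ∑ k, (cs k).y * ∑' i, T k i = ∑' i, m i * cutNumer cs w (a i) := by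
    have e1 : ∀ k, (cs k).y * ∑' i, T k i = ∑' i, (cs k).y * T k i := fun k => (tsum_mul_left).symm
    simp_rw [e1]
    rw [← Summable.tsum_finsetSum (fun k _ => hsum' k)]
    refine tsum_congr fun i => ?_
    unfold cutNumer
    rw [Finset.mul_sum]
    refine Finset.sum_congr rfl fun k _ => ?_
    simp only [hT]
    ring
  have hsumN : Summable fun i => m i * cutNumer cs w (a i) := by
    have : (fun i => m i * cutNumer cs w (a i)) = fun i => ∑ k, (cs k).y * T k i := by
      funext i
      unfold cutNumer
      rw [Finset.mul_sum]
      refine Finset.sum_congr rfl fun k _ => ?_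
      simp only [hT]
      ring
    rw [this]
    exact summable_sum fun k _ => hsum' k
  have hsumS : Summable fun i => m i * (σ * farPairC w (a i)) := by
    have : (fun i => m i * (σ * farPairC w (a i))) = fun i => σ * (m i * farPairC w (a i)) := by
      funext i; ring
    rw [this]
    exact hsumc.mul_left σ
  have h4 : ∑' i, m i * cutNumer cs w (a i) ≤ ∑' i, m i * (σ * farPairC w (a i)) :=
    Summable.tsum_le_tsum (fun i => mul_le_mul_of_nonneg_left (hK i) (hm i)) hsumN hsumS
  have h5 : ∑' i, m i * (σ * farPairC w (a i)) = σ * ∑' i, m i * farPairC w (a i) := by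
    rw [← tsum_mul_left]
    exact tsum_congr fun i => by ring
  unfold Lcert
  rw [hE]
  linarith [h2, h3, h4, h5]

/-- ★ THIN-STRIP ASSEMBLY: a far family inside the thin strip of lid height `Hs` and kernel domination on that thin strip give `L_cert ≤ L` — the same
conclusion as `sinkAssembly`, from the region the frame actually populates. -/
theorem assembly_thin (κ : Type) [Fintype κ] (ι : Type) (a : ι → ℂ) (m : ι → ℝ) (xv R Hs : ℝ) (cs : κ → Cut) (w G : ℂ) (L σ : ℝ)
    (hm : ∀ i, 0 ≤ m i) (hstrip : ∀ i, ThinStrip xv R Hs (a i)) (hadm : CutsAdmissible xv cs) (hK : KernelDomThin xv R Hs cs w σ)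
    (hsum : ∀ k, Summable fun i => m i * (conj (cs k).e * (farPairK (a i) w - farPairK (a i) (cs k).p)).re)
    (hsumc : Summable fun i => m i * farPairC w (a i)) (hE : -G.im = ∑' i, m i * farPairC w (a i))
    (hseam : ∀ k, (conj (cs k).e * G).re - ∑' i, m i * (conj (cs k).e * (farPairK (a i) w - farPairK (a i) (cs k).p)).re ≤ L) :
    Lcert cs G σ ≤ L :=
  lcert_le_of_pointwise κ ι a m xv cs w G L σ hm hadm (fun i => hK (a i) (hstrip i)) hsum hsumc hE hseam

/-- a far zero with `|Im u| ≤ Hs` outside the near window lies in the thin strip (this is all the frame supplies: `R/2 ≤ |Re u − xv|` and the zero-height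
bound `Hs`). -/
theorem thinStrip_of_far {xv R Hs : ℝ} {u : ℂ} (hfar : R / 2 ≤ |u.re - xv|) (him : |u.im| ≤ Hs) : ThinStrip xv R Hs u := ⟨hfar, him⟩

end RhW08.SinkThin
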